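import Mathlib.RingTheory.AlgebraicIndependent.Transcendental
import Mathlib.Topology.Separation.Basic
import Mathlib.Analysis.Normed.Module.Basic
import Literature.ModelTheory.ExponentialFields.SemialgebraicInterior
import Literature.NumberTheory.Transcendental.KZSemialgebraicComplex
import HarnessLib

/-!
# Transcendental points of the line are generic for `ℚ`-semialgebraic sets

For the `ℚ`-semialgebraic subsets of `ℝ¹ = (Fin 1 → ℝ)` (Boolean combinations of sign conditions on
polynomials with RATIONAL coefficients, `Literature.ModelTheory.ExponentialFields.IsSemialgebraic ℚ`) a
point `x` whose coordinate is transcendental over `ℚ` is GENERIC: every such set is either a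
neighbourhood of `x` or disjoint from a neighbourhood of `x` (`nhds_or_compl_mem_nhds_of_transcendental`):
a non-zero rational polynomial does not vanish at `x`, so each generating sign condition is decided on a
neighbourhood of `x` by continuity, and the property is preserved by the Boolean operations. Consequences
(all elementary real algebraic geometry over the field of definition `ℚ`, cf. Bochnak–Coste–Roy 1998, §2.1
and Prop. 2.1.9 / the description of semialgebraic subsets of the line, with coefficients in a subfield as in
Basu–Pollack–Roy 2006, §2.3–2.5):

* `isAlgebraic_of_not_mem_nhds` — a point of `ℝ¹` at which a `ℚ`-semialgebraic set is neither a
  neighbourhood nor co-neighbourhood is ALGEBRAIC over `ℚ`; in particular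
* `isAlgebraic_of_mem_frontier` — boundary points of `ℚ`-semialgebraic subsets of `ℝ¹` are algebraic;
* `isAlgebraic_of_mem_of_finite` — points of finite `ℚ`-semialgebraic subsets of `ℝ¹` are algebraic;
* `IsSemialgebraicFunOn.isAlgebraic_apply` — the value of a `ℚ`-semialgebraic function `ℝᵐ ⊇ s → ℝ` at a
  point of `s` with algebraic coordinates is algebraic (the fibre of the graph is a `ℚ`-semialgebraic
  singleton, by Tarski–Seidenberg).

These are the "break points and end values are algebraic" inputs of cell decompositions of
one-dimensional Kontsevich–Zagier integral representations (the converse direction,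
`isSemialgebraic_setOf_apply_eq_of_isAlgebraic` / `isSemialgebraicFunOn_const_of_isAlgebraic`, is in
`KZSemialgebraicComplex.lean`).

## References
* J. Bochnak, M. Coste, M.-F. Roy, *Real Algebraic Geometry*, Springer 1998, §2.1.
* S. Basu, R. Pollack, M.-F. Roy, *Algorithms in Real Algebraic Geometry*, Springer 2006, §2.
-/

noncomputable section

open Set Filter Topology
open Literature.ModelTheory.ExponentialFields

namespace Literature.NumberTheory.Transcendental

/-- **Transcendental points are generic.** If `x 0` is transcendental over `ℚ`, then every
`ℚ`-semialgebraic `s ⊆ ℝ¹` is a neighbourhood of `x` or has a neighbourhood of `x` in its complement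
(induction over the Boolean algebra generated by `{p = 0}`, `{p > 0}`, `p ∈ ℚ[X]`: a non-zero `p`
does not vanish at `x`, and its sign is locally constant). [folklore] -/
theorem nhds_or_compl_mem_nhds_of_transcendental {x : Fin 1 → ℝ} (hx : Transcendental ℚ (x 0))
    {s : Set (Fin 1 → ℝ)} (hs : IsSemialgebraic ℚ s) : s ∈ 𝓝 x ∨ sᶜ ∈ 𝓝 x := by
  have hinj : Function.Injective (MvPolynomial.aeval x : MvPolynomial (Fin 1) ℚ →ₐ[ℚ] ℝ) :=
    (algebraicIndependent_singleton_iff (R := ℚ) (x := x) (0 : Fin 1)).2 hx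
  have hne : ∀ p : MvPolynomial (Fin 1) ℚ, p ≠ 0 → MvPolynomial.aeval x p ≠ 0 := fun p hp h =>
    hp (hinj (by rw [h, map_zero]))
  induction hs using BooleanSubalgebra.closure_bot_sup_induction with
  | mem t ht =>
    rcases ht with ⟨p, rfl⟩ | ⟨p, rfl⟩
    · by_cases hp : p = 0
      · left
        subst hp
        simp
      · right
        have hopen : IsOpen {y : Fin 1 → ℝ | MvPolynomial.aeval y p ≠ 0} :=
          isOpen_ne_fun (continuous_aeval_real p) continuous_const
        have hmem : {y : Fin 1 → ℝ | MvPolynomial.aeval y p ≠ 0} ∈ 𝓝 x := hopen.mem_nhds (hne p hp)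
        simpa [compl_setOf] using hmem
    · by_cases hp : p = 0
      · right
        subst hp
        simp
      · rcases lt_or_gt_of_ne (hne p hp) with hlt | hgt
        · right
          have hopen : IsOpen {y : Fin 1 → ℝ | MvPolynomial.aeval y p < 0} :=
            isOpen_lt (continuous_aeval_real p) continuous_const
          filter_upwards [hopen.mem_nhds hlt] with y hy
          simp only [mem_compl_iff, mem_setOf_eq, not_lt]
          exact le_of_lt hy
        · left
          exact (isOpen_lt continuous_const (continuous_aeval_real p)).mem_nhds hgt
  | bot =>
    right
    simp
  | sup t _ u _ iht ihu =>
    rcases iht with ht | ht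
    · exact Or.inl (mem_of_superset ht subset_union_left)
    · rcases ihu with hu | hu
      · exact Or.inl (mem_of_superset hu subset_union_right)
      · right
        have h : (t ⊔ u)ᶜ = tᶜ ∩ uᶜ := by
          show (t ∪ u)ᶜ = tᶜ ∩ uᶜ
          exact compl_union t u
        rw [h]
        exact inter_mem ht hu
  | compl t _ iht =>
    rcases iht with ht | ht
    · right
      simpa only [compl_compl] using ht
    · exact Or.inl ht

/-- A point of `ℝ¹` at which a `ℚ`-semialgebraic set is neither a neighbourhood of the point nor
disjoint from a neighbourhood of it has ALGEBRAIC coordinate. [folklore] -/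
theorem isAlgebraic_of_not_mem_nhds {x : Fin 1 → ℝ} {s : Set (Fin 1 → ℝ)} (hs : IsSemialgebraic ℚ s)
    (h₁ : s ∉ 𝓝 x) (h₂ : sᶜ ∉ 𝓝 x) : IsAlgebraic ℚ (x 0) := by
  by_contra hx
  rcases nhds_or_compl_mem_nhds_of_transcendental hx hs with h | h
  · exact h₁ h
  · exact h₂ h

/-- **Boundary points of `ℚ`-semialgebraic subsets of the line are algebraic.** [folklore] -/
theorem isAlgebraic_of_mem_frontier {x : Fin 1 → ℝ} {s : Set (Fin 1 → ℝ)} (hs : IsSemialgebraic ℚ s)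
    (hx : x ∈ frontier s) : IsAlgebraic ℚ (x 0) := by
  rw [frontier, Set.mem_sdiff] at hx
  refine isAlgebraic_of_not_mem_nhds hs (fun h => hx.2 (mem_interior_iff_mem_nhds.2 h)) fun h => ?_
  have hx' : x ∈ interior sᶜ := mem_interior_iff_mem_nhds.2 h
  rw [interior_compl] at hx'
  exact hx' hx.1

/-- A point of a `ℚ`-semialgebraic subset of the line which is not an interior point is algebraic.
[folklore] -/
theorem isAlgebraic_of_mem_of_not_mem_nhds {x : Fin 1 → ℝ} {s : Set (Fin 1 → ℝ)}
    (hs : IsSemialgebraic ℚ s) (hx : x ∈ s) (h : s ∉ 𝓝 x) : IsAlgebraic ℚ (x 0) :=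
  isAlgebraic_of_not_mem_nhds hs h fun h' => (mem_of_mem_nhds h') hx

/-- **Points of finite `ℚ`-semialgebraic subsets of the line are algebraic** (a finite set is not a
neighbourhood of any real point). [folklore] -/
theorem isAlgebraic_of_mem_of_finite {x : Fin 1 → ℝ} {s : Set (Fin 1 → ℝ)} (hs : IsSemialgebraic ℚ s)
    (hfin : s.Finite) (hx : x ∈ s) : IsAlgebraic ℚ (x 0) :=
  isAlgebraic_of_mem_of_not_mem_nhds hs hx fun h => (infinite_of_mem_nhds x h) hfin

/-- The singleton `{x} ⊆ ℝ¹` is `ℚ`-semialgebraic iff `x 0` is algebraic over `ℚ`. [folklore] -/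
theorem isSemialgebraic_singleton_iff (x : Fin 1 → ℝ) :
    IsSemialgebraic ℚ ({x} : Set (Fin 1 → ℝ)) ↔ IsAlgebraic ℚ (x 0) := by
  refine ⟨fun h => isAlgebraic_of_mem_of_finite h (finite_singleton x) (mem_singleton x), fun h => ?_⟩
  convert isSemialgebraic_setOf_apply_eq_of_isAlgebraic h (0 : Fin 1) using 1
  ext y
  simp only [mem_singleton_iff, mem_setOf_eq]
  constructor
  · rintro rfl
    rfl
  · intro hy
    funext i
    rw [Subsingleton.elim i 0, hy]

/-- **Values of `ℚ`-semialgebraic functions at algebraic points are algebraic.** If `f` is a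
`ℚ`-semialgebraic function on `s ⊆ ℝᵐ` and `a ∈ s` has algebraic coordinates, then `f a` is algebraic
over `ℚ`: the set `{y ∈ ℝ¹ | y 0 = f a}` is the coordinate image of the `ℚ`-semialgebraic set
`graph(f) ∩ {z | init z = a}` (Tarski–Seidenberg), a `ℚ`-semialgebraic singleton. [folklore] -/
theorem IsSemialgebraicFunOn.isAlgebraic_apply {m : ℕ} {s : Set (Fin m → ℝ)} {f : (Fin m → ℝ) → ℝ}
    (hf : IsSemialgebraicFunOn ℚ s f) {a : Fin m → ℝ} (ha : a ∈ s) (halg : ∀ i, IsAlgebraic ℚ (a i)) :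
    IsAlgebraic ℚ (f a) := by
  -- the graph of `f` over `s`, pinned over the point `a`
  have hG : IsSemialgebraic ℚ
      ({z : Fin (m + 1) → ℝ | Fin.init z ∈ s ∧ z (Fin.last m) = f (Fin.init z)} ∩
        ⋂ i ∈ (Finset.univ : Finset (Fin m)), {z : Fin (m + 1) → ℝ | z (Fin.castSucc i) = a i}) := by
    refine (isSemialgebraicFunOn_iff.1 hf).inter (IsSemialgebraic.biInter _ _ fun i _ => ?_)
    exact isSemialgebraic_setOf_apply_eq_of_isAlgebraic (halg i) (Fin.castSucc i)
  -- its image under the last-coordinate map is the singleton `{(f a)}`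
  have himg := hG.image_comp (fun _ : Fin 1 => Fin.last m)
  have heq : ((fun w : Fin (m + 1) → ℝ => w ∘ fun _ : Fin 1 => Fin.last m) ''
      ({z : Fin (m + 1) → ℝ | Fin.init z ∈ s ∧ z (Fin.last m) = f (Fin.init z)} ∩
        ⋂ i ∈ (Finset.univ : Finset (Fin m)), {z : Fin (m + 1) → ℝ | z (Fin.castSucc i) = a i})) =
      ({fun _ : Fin 1 => f a} : Set (Fin 1 → ℝ)) := by
    ext y
    simp only [mem_image, mem_inter_iff, mem_setOf_eq, mem_iInter, Finset.mem_univ, true_implies,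
      mem_singleton_iff]
    constructor
    · rintro ⟨z, ⟨⟨_, hz⟩, hza⟩, rfl⟩
      have hinit : Fin.init z = a := funext fun i => hza i
      funext j
      simp only [Function.comp_apply]
      rw [hz, hinit]
    · rintro rfl
      refine ⟨Fin.snoc a (f a), ⟨⟨?_, ?_⟩, fun i => ?_⟩, ?_⟩
      · simpa using ha
      · simp
      · simp
      · funext j
        simp
  rw [heq] at himg
  exact isAlgebraic_of_mem_of_finite himg (finite_singleton _) (mem_singleton _)

/-- One-variable form: the value of a `ℚ`-semialgebraic function of one real variable at an algebraic
point of its domain is algebraic. [folklore] -/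
theorem IsSemialgebraicFunOn.isAlgebraic_apply_one {S : Set ℝ} {u : ℝ → ℝ}
    (hu : IsSemialgebraicFunOn ℚ {z : Fin 1 → ℝ | z 0 ∈ S} (fun z => u (z 0))) {t : ℝ} (ht : t ∈ S)
    (halg : IsAlgebraic ℚ t) : IsAlgebraic ℚ (u t) :=
  hu.isAlgebraic_apply (a := fun _ => t) (by simpa using ht) fun _ => halg

end Literature.NumberTheory.Transcendental

end
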